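import Summits.CriticalPhenomena.PercolationContinuityZ3.Theorems.Transplant.FKConnectivityAllQGluing
import Literature.Probability.Percolation.TwoSetConditionalAssociationRC
import Literature.Probability.Percolation.KozmaNitzanPreFKG
import Literature.Probability.Percolation.PercolationEvents
import HarnessLib

/-!
# Connectivity correlation inequalities for every `q > 0` — file 3 of 3: the discharge for `q ≥ 1`
# (vdBHK Thm. 2.1 for `rcMeasureW` and FKG): `HubFK q`, `HubCondFK q`, `TwoArmNegFK q`, `FourPointFK q`, `AdditiveGluingTwoFK q`,
# and Kozma–Nitzan's Theorem 1 (pre-FKG for relay pairs) for every random-cluster measure `φ_{w,q}` with `q ≥ 1`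

Support file (`--supports stmt-CriticalPhenomena-4575`), FK sub-lane `prim-bschramm-fk-1` (gen 4); builds on p205010 (kernel theorem,
internal audit signed; external expert review pending).  No named facts, no sorries; standard axioms.  The `q < 1` halves of the
conjecture nodes of `…FKConnectivityAllQDefs.lean` remain open; nothing is claimed about them here.
[cite: VandenbergHaggstromKahn2005, Thms. 1.3, 1.4 (pp. 6–7), Thm. 2.1 (p. 9)] [cite: KozmaNitzan2024, Thm. 1 (p. 7)] [cite: Grimmett2006, Thm. (3.8)]
-/

noncomputable section

namespace Summit.CriticalPhenomena.PercolationContinuityZ3.Theorems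

namespace FK

open MeasureTheory Set Literature.Probability.LatticeModels Literature.Probability.Percolation
open scoped Classical

/-! ### (3) Discharge for `q ≥ 1` (vdBHK Thm. 2.1 for `rcMeasureW`, and FKG) -/

section OneLe

variable {n : ℕ}

/-- The indicator of the connectivity family `connFamily s x` (Kozma–Nitzan/vdBHK vocabulary of the tree,
`KNPreFKG.connFamily`: "`x = s` or some edge of the cluster contains `x`"), evaluated at the open edge cluster `C_s(ω)`, is the
indicator of the connection event `{x ↔ s}`. [cite: VandenbergHaggstromKahn2005, §1 p. 3 (C_s)] -/
theorem indicator_connFamily_openEdgeCluster (s x : Fin n) (ω : BondConfig (Fin n)) :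
    (KNPreFKG.connFamily s x).indicator (1 : Set (Sym2 (Fin n)) → ℝ) (openEdgeCluster ω s) = (openConn x s).indicator 1 ω := by
  have h := congrFun (KNPreFKG.indicator_comp_openEdgeCluster (KNPreFKG.connFamily s x) s) ω
  rw [KNPreFKG.openConn_symm x s, KNPreFKG.openConn_eq_setOf_connFamily s x]
  exact h

/-- Integral of an indicator of an event over an event = measure of the intersection. [folklore] -/
theorem setIntegral_indicator_one_inter (μ : Measure (BondConfig (Fin n))) [IsFiniteMeasure μ] (D E : Set (BondConfig (Fin n))) :
    ∫ ω in D, E.indicator (1 : BondConfig (Fin n) → ℝ) ω ∂μ = μ.real (E ∩ D) := by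
  rw [KNPreFKG.setIntegral_indicator_one_eq, Set.inter_comm]

/-- Product of two indicators with value one, pointwise. [folklore] -/
theorem indicator_one_mul_indicator_one_apply (E E' : Set (BondConfig (Fin n))) (ω : BondConfig (Fin n)) :
    E.indicator (1 : BondConfig (Fin n) → ℝ) ω * E'.indicator 1 ω = (E ∩ E').indicator 1 ω :=
  congrFun (KNPreFKG.indicator_one_mul_indicator_one E E') ω

/-- **Conditioned hub inequality for `φ_{w,q}`, `q ≥ 1`** — vdBHK Thm. 2.1 for `rcMeasureW` (tree theorem
`BHK2006_twoClusterConditionalAssociation_rc`) applied to the two increasing connectivity functions of `C_a` given `{a ↮ c}`.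
[cite: VandenbergHaggstromKahn2005, Thm. 2.1 (p. 9), Thm. 1.3 (p. 6)] -/
theorem hubCondFK_of_one_le {q : ℝ} (hq : 1 ≤ q) : HubCondFK q := by
  intro n w o a b c
  have hq0 : 0 < q := one_pos.trans_le hq
  haveI := isProbabilityMeasure_rcMeasureW w hq0 (∅ : Set (Fin n))
  have key := BHK2006_twoClusterConditionalAssociation_rc w hq a c
    (fun C _ => (KNPreFKG.connFamily a o).indicator (1 : Set (Sym2 (Fin n)) → ℝ) C)
    (fun C _ => (KNPreFKG.connFamily a b).indicator (1 : Set (Sym2 (Fin n)) → ℝ) C)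
    (fun _ => KNPreFKG.monotone_indicator_one_of_isUpperSet (KNPreFKG.isUpperSet_connFamily a o)) (fun _ => antitone_const)
    (fun _ => KNPreFKG.monotone_indicator_one_of_isUpperSet (KNPreFKG.isUpperSet_connFamily a b)) (fun _ => antitone_const)
  have hD : {ω : BondConfig (Fin n) | ¬ (openGraph ω).Reachable a c} = sepEv a c := rfl
  simp only [hD, indicator_connFamily_openEdgeCluster, indicator_one_mul_indicator_one_apply,
    setIntegral_indicator_one_inter] at key
  exact key

/-- **Two-arm negative correlation for `φ_{w,q}`, `q ≥ 1`** — vdBHK Thm. 2.1 (tree theorem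
`BHK2006_twoClusterConditionalAssociation_rc_negCorrelation`) for the connectivity functions of `C_a` and `C_c` given `{a ↮ c}`.
[cite: VandenbergHaggstromKahn2005, Thm. 2.1 (p. 9), Thm. 1.4 (p. 7)] -/
theorem twoArmNegFK_of_one_le {q : ℝ} (hq : 1 ≤ q) : TwoArmNegFK q := by
  intro n w o a b c
  have hq0 : 0 < q := one_pos.trans_le hq
  haveI := isProbabilityMeasure_rcMeasureW w hq0 (∅ : Set (Fin n))
  have key := BHK2006_twoClusterConditionalAssociation_rc_negCorrelation w hq a c
    ((KNPreFKG.connFamily a o).indicator (1 : Set (Sym2 (Fin n)) → ℝ))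
    ((KNPreFKG.connFamily c b).indicator (1 : Set (Sym2 (Fin n)) → ℝ))
    (KNPreFKG.monotone_indicator_one_of_isUpperSet (KNPreFKG.isUpperSet_connFamily a o))
    (KNPreFKG.monotone_indicator_one_of_isUpperSet (KNPreFKG.isUpperSet_connFamily c b))
  have hD : {ω : BondConfig (Fin n) | ¬ (openGraph ω).Reachable a c} = sepEv a c := rfl
  simp only [hD, indicator_connFamily_openEdgeCluster, indicator_one_mul_indicator_one_apply,
    setIntegral_indicator_one_inter] at key
  exact key

/-- **Hub inequality for `φ_{w,q}`, `q ≥ 1`** — FKG (`rcMeasureW_fkg`) for the two increasing events `{o ↔ a}`, `{b ↔ a}`.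
[cite: Grimmett2006, Thm. (3.8)] -/
theorem hubFK_of_one_le {q : ℝ} (hq : 1 ≤ q) : HubFK q := by
  intro n w o a b
  have hq0 : 0 < q := one_pos.trans_le hq
  haveI := isProbabilityMeasure_rcMeasureW w hq0 (∅ : Set (Fin n))
  unfold HubUnder
  rw [probReal_univ, one_mul]
  exact rcMeasureW_fkg w hq ∅ (isUpperSet_openConn o a) (isUpperSet_openConn b a)

/-- **Four-point inequality for `φ_{w,q}`, `q ≥ 1`.** [cite: KozmaNitzan2024, Thm. 1 (p. 7)] [cite: VandenbergHaggstromKahn2005, Thm. 2.1 (p. 9)] -/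
theorem fourPointFK_of_one_le {q : ℝ} (hq : 1 ≤ q) : FourPointFK q :=
  fourPointFK_of_hubCond_twoArmNeg (one_pos.trans_le hq) (hubCondFK_of_one_le hq) (twoArmNegFK_of_one_le hq)

/-- **Additive gluing for `φ_{w,q}`, `q ≥ 1`, relay sets of size `≤ 2`** by the four-point route (independent of the CSH chain;
the full statement for all relay sets and `q ≥ 1` is the tree theorem `FK.additiveGluingFK_of_one_le`).
[cite: KozmaNitzan2024, Thm. 1 (p. 7)] -/
theorem additiveGluingTwoFK_of_one_le {q : ℝ} (hq : 1 ≤ q) : AdditiveGluingTwoFK q :=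
  additiveGluingTwoFK_of_fourPointFK (one_pos.trans_le hq) (fourPointFK_of_one_le hq)

/-- **Pre-FKG (3) for `φ_{w,q}`, `q ≥ 1`, relay pairs** — Kozma–Nitzan's Theorem 1 transplanted to every random-cluster measure with
`q ≥ 1`. [cite: KozmaNitzan2024, Thm. 1 (p. 7)] -/
theorem preFKGPair_of_one_le {q : ℝ} (hq : 1 ≤ q) (w : Sym2 (Fin n) → unitInterval) (o a c b : Fin n) :
    PreFKGPairUnder (rcMeasureW w q ∅) o a c b := by
  haveI := isProbabilityMeasure_rcMeasureW w (one_pos.trans_le hq) (∅ : Set (Fin n))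
  exact preFKGPairUnder_of_fourPoint _ o a c b (fourPointFK_of_one_le hq n w o a c b)

end OneLe

end FK

end Summit.CriticalPhenomena.PercolationContinuityZ3.Theorems

end
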